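import Literature.NumberTheory.Transcendental.RoySmallValueThresholds
import Literature.NumberTheory.Transcendental.RoySmallValueDistance
import HarnessLib

/-!
# Roy's small value estimate for `𝔾ₐ × 𝔾ₘ` — the junk constant `Γ''` of Step 2 is `o(D^β)`

Topic `Literature/NumberTheory/Transcendental`. Part of the formalisation of the proof of Roy 2013,
Theorem 1.1 (named fact `roy2013_thm_1_1`, `RoySmallValueEstimates.lean`), seat B. Source: D. Roy,
*A small value estimate for `𝔾ₐ × 𝔾ₘ`*, Mathematika 59 (2013) 333–363 = arXiv:1301.0663, §7,
Step 2 (p. 18):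

> `≤ ∑_{α∈Z} log|I_D^{(γ,T)}|_α + 7T(log T)² deg(Z) ≤ −(D^δ/25)(D^β deg(Z) + Dh(Z))`
> if `D` is large enough (because `β > τ ≥ 1`).

The constant `Γ''` of `ZeroConfigK.step2_distance_sum` (built from the constants of the tree's
`prop_4_5_i/ii`, i.e. Roy's `c₅^T T^{6T log T}`) plays the role of `7T(log T)²`. This file bounds
it: `Γ'' ≤ S(T, k)` for an explicit `S` (`gamma_le`), and `S(T, k) ≤ n^β` for all large `n`
whenever `1 ≤ T ≤ n^τ` and `k ≤ 1 + 3 log n` (`eventually_S_le`). Everything is proved; no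
definitions, no named facts.

## References

* [Roy2013] D. Roy, *A small value estimate for 𝔾ₐ × 𝔾ₘ*, Mathematika 59 (2013), 333–363
  (arXiv:1301.0663), §7, Step 2 (the term `7T(log T)²`).
-/

noncomputable section

open Filter Real Finset

namespace Literature.NumberTheory.Transcendental

namespace Roy2013

set_option maxHeartbeats 400000 in
/-- **`Γ''(T, k) ≤ S(T, k)`**: the junk constant of `step2_distance_sum` is at most
`(T+2) log 2 + 2T log(2c₂) + T log(2c₂²) + log(1 + c₂e^{1+c₂}) + log c₂ + c₂ + 2k·ℓ(T)`,
`ℓ(T) = log 3 + T log X + T log(16T³)`, `X = 3(1+|ξ|+|η|⁻¹)c₂` (`T ≥ 1`).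
[cite: Roy2013, §7, Step 2 (`7T(log T)²`)] -/
theorem gamma_le (ξ η : ℂ) {T : ℕ} (hT : 1 ≤ T) (k : ℕ) :
    max ((max (Real.log (2 ^ T * (3 * (3 * (1 + ‖ξ‖ + ‖η‖⁻¹) * max 1 (max ‖ξ‖ ‖η‖)) ^ T *
              (16 * (T : ℝ) ^ 3) ^ T) ^ k))
            (Real.log (2 * ((2 * roy_c2 ξ η) ^ T * (1 + roy_c2 ξ η * Real.exp (1 + roy_c2 ξ η)) *
              (3 * (3 * (1 + ‖ξ‖ + ‖η‖⁻¹) * max 1 (max ‖ξ‖ ‖η‖)) ^ T *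
                (16 * (T : ℝ) ^ 3) ^ T) ^ k))) +
          |Real.log (2 * (roy_c2 ξ η * Real.exp (roy_c2 ξ η) * (2 * roy_c2 ξ η ^ 2) ^ T))|))
          (Real.log (2 ^ T * (3 * (3 * (1 + ‖ξ‖ + ‖η‖⁻¹) * max 1 (max ‖ξ‖ ‖η‖)) ^ T *
              (16 * (T : ℝ) ^ 3) ^ T) ^ k) - T * Real.log ((2 * roy_c2 ξ η)⁻¹)) ≤
      (T + 2) * Real.log 2 + 2 * T * Real.log (2 * roy_c2 ξ η) + T * Real.log (2 * roy_c2 ξ η ^ 2) +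
        Real.log (1 + roy_c2 ξ η * Real.exp (1 + roy_c2 ξ η)) + Real.log (roy_c2 ξ η) + roy_c2 ξ η +
        2 * k * (Real.log 3 + T * Real.log (3 * (1 + ‖ξ‖ + ‖η‖⁻¹) * max 1 (max ‖ξ‖ ‖η‖)) +
          T * Real.log (16 * (T : ℝ) ^ 3)) := by
  -- names
  have hc2 : 1 ≤ roy_c2 ξ η := one_le_roy_c2 ξ η
  have hc2' : roy_c2 ξ η = max 1 (max ‖ξ‖ ‖η‖) := rfl
  obtain ⟨c, hc⟩ : ∃ c : ℝ, c = roy_c2 ξ η := ⟨_, rfl⟩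
  obtain ⟨X, hX⟩ : ∃ X : ℝ, X = 3 * (1 + ‖ξ‖ + ‖η‖⁻¹) * max 1 (max ‖ξ‖ ‖η‖) := ⟨_, rfl⟩
  rw [← hc, ← hX]
  rw [← hc] at hc2
  have hTr : (1 : ℝ) ≤ T := by exact_mod_cast hT
  have hX3 : 3 ≤ X := by
    rw [hX, ← hc2']; rw [← hc]
    have : 0 ≤ ‖ξ‖ := norm_nonneg _; have : 0 ≤ ‖η‖⁻¹ := inv_nonneg.mpr (norm_nonneg _)
    nlinarith
  have hX1 : 1 ≤ X := by linarith
  obtain ⟨Λ, hΛ⟩ : ∃ Λ : ℝ, Λ = 3 * X ^ T * (16 * (T : ℝ) ^ 3) ^ T := ⟨_, rfl⟩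
  have h16 : (16 : ℝ) ≤ 16 * (T : ℝ) ^ 3 := by nlinarith [one_le_pow₀ (n := 3) hTr]
  have hΛ1 : 1 ≤ Λ := by
    rw [hΛ]
    have := one_le_pow₀ (n := T) hX1
    have := one_le_pow₀ (n := T) (show (1 : ℝ) ≤ 16 * (T : ℝ) ^ 3 by linarith)
    nlinarith
  obtain ⟨ℓ, hℓ⟩ : ∃ ℓ : ℝ, ℓ = Real.log 3 + T * Real.log X + T * Real.log (16 * (T : ℝ) ^ 3) := ⟨_, rfl⟩
  have hlogΛ : Real.log Λ = ℓ := by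
    rw [hΛ, hℓ, Real.log_mul (by positivity) (by positivity), Real.log_mul (by norm_num) (by positivity),
      Real.log_pow, Real.log_pow]
  have hℓ0 : 0 ≤ ℓ := by rw [← hlogΛ]; exact Real.log_nonneg hΛ1
  rw [← hΛ, ← hℓ]
  -- the three logs
  have hlogA : Real.log (2 ^ T * Λ ^ k) = T * Real.log 2 + k * ℓ := by
    rw [Real.log_mul (by positivity) (by positivity), Real.log_pow, Real.log_pow, hlogΛ]
  have hpos1 : 0 < 1 + c * Real.exp (1 + c) := by positivity
  have hlogCc : Real.log (2 * ((2 * c) ^ T * (1 + c * Real.exp (1 + c)) * Λ ^ k)) =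
      Real.log 2 + T * Real.log (2 * c) + Real.log (1 + c * Real.exp (1 + c)) + k * ℓ := by
    rw [Real.log_mul (by norm_num) (by positivity), Real.log_mul (by positivity) (by positivity),
      Real.log_mul (by positivity) hpos1.ne', Real.log_pow, Real.log_pow, hlogΛ]; ring
  have hlogC' : Real.log (2 * (c * Real.exp c * (2 * c ^ 2) ^ T)) =
      Real.log 2 + Real.log c + c + T * Real.log (2 * c ^ 2) := by
    rw [Real.log_mul (by norm_num) (by positivity), Real.log_mul (by positivity) (by positivity),
      Real.log_mul (by positivity) (Real.exp_pos c).ne', Real.log_exp, Real.log_pow]; ring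
  have hlogC'0 : 0 ≤ Real.log (2 * (c * Real.exp c * (2 * c ^ 2) ^ T)) := by
    refine Real.log_nonneg ?_
    have h1 : (1 : ℝ) ≤ 2 * c ^ 2 := by nlinarith
    have h2 := one_le_pow₀ (n := T) h1
    have h3 : (1 : ℝ) ≤ Real.exp c := by have := Real.add_one_le_exp c; linarith
    nlinarith [mul_le_mul hc2 h3 zero_le_one (by linarith : (0:ℝ) ≤ c)]
  rw [abs_of_nonneg hlogC'0, hlogA, hlogCc, hlogC', Real.log_inv]
  -- nonnegativity of the pieces
  have hl2 : 0 ≤ Real.log 2 := Real.log_nonneg (by norm_num)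
  have hl2c : 0 ≤ Real.log (2 * c) := Real.log_nonneg (by linarith)
  have hl2c2 : 0 ≤ Real.log (2 * c ^ 2) := Real.log_nonneg (by nlinarith)
  have hl1c : 0 ≤ Real.log (1 + c * Real.exp (1 + c)) := Real.log_nonneg (by
    have := mul_nonneg (by linarith : (0 : ℝ) ≤ c) (Real.exp_pos (1 + c)).le; linarith)
  have hlc : 0 ≤ Real.log c := Real.log_nonneg hc2
  have hkℓ : 0 ≤ (k : ℝ) * ℓ := mul_nonneg (Nat.cast_nonneg _) hℓ0
  have hT0 : (0 : ℝ) ≤ T := Nat.cast_nonneg _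
  refine max_le ?_ (by nlinarith)
  rw [← max_add_add_right]
  exact max_le (by nlinarith) (by nlinarith)

/-- **`S(T, k) ≤ n^β` for large `n`** whenever `1 ≤ T ≤ n^τ` and `k ≤ 1 + 3 log n` (`0 < τ < β`).
[cite: Roy2013, §7, Step 2 ("if `D` is large enough (because `β > τ ≥ 1`)")] -/
theorem eventually_S_le (ξ η : ℂ) {τ β : ℝ} (hτ0 : 0 < τ) (hτβ : τ < β) :
    ∀ᶠ n : ℕ in atTop, ∀ T k : ℕ, 1 ≤ T → (T : ℝ) ≤ (n : ℝ) ^ τ → (k : ℝ) ≤ 1 + 3 * Real.log n →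
      (T + 2) * Real.log 2 + 2 * T * Real.log (2 * roy_c2 ξ η) + T * Real.log (2 * roy_c2 ξ η ^ 2) +
        Real.log (1 + roy_c2 ξ η * Real.exp (1 + roy_c2 ξ η)) + Real.log (roy_c2 ξ η) + roy_c2 ξ η +
        2 * k * (Real.log 3 + T * Real.log (3 * (1 + ‖ξ‖ + ‖η‖⁻¹) * max 1 (max ‖ξ‖ ‖η‖)) +
          T * Real.log (16 * (T : ℝ) ^ 3)) ≤ (n : ℝ) ^ β := by
  have hβ0 : 0 < β := hτ0.trans hτβ
  obtain ⟨c, hc⟩ : ∃ c : ℝ, c = roy_c2 ξ η := ⟨_, rfl⟩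
  have hc1 : 1 ≤ c := by rw [hc]; exact one_le_roy_c2 ξ η
  obtain ⟨X, hX⟩ : ∃ X : ℝ, X = 3 * (1 + ‖ξ‖ + ‖η‖⁻¹) * max 1 (max ‖ξ‖ ‖η‖) := ⟨_, rfl⟩
  have hX3 : 3 ≤ X := by
    rw [hX]
    have h1 : (1 : ℝ) ≤ max 1 (max ‖ξ‖ ‖η‖) := le_max_left _ _
    have : 0 ≤ ‖ξ‖ := norm_nonneg _; have : 0 ≤ ‖η‖⁻¹ := inv_nonneg.mpr (norm_nonneg _)
    nlinarith
  -- the constants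
  obtain ⟨K₁, hK₁⟩ : ∃ K₁ : ℝ, K₁ = Real.log 2 + 2 * Real.log (2 * c) + Real.log (2 * c ^ 2) := ⟨_, rfl⟩
  obtain ⟨K₂, hK₂⟩ : ∃ K₂ : ℝ, K₂ = 2 * Real.log 2 + Real.log (1 + c * Real.exp (1 + c)) +
      Real.log c + c + 2 * Real.log 3 := ⟨_, rfl⟩
  obtain ⟨K₃, hK₃⟩ : ∃ K₃ : ℝ, K₃ = Real.log X := ⟨_, rfl⟩
  have hK₃0 : 0 ≤ K₃ := by rw [hK₃]; exact Real.log_nonneg (by linarith)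
  have hl16 : 0 ≤ Real.log 16 := Real.log_nonneg (by norm_num)
  have hl3 : 0 ≤ Real.log 3 := Real.log_nonneg (by norm_num)
  filter_upwards [eventually_term_le_div 0 β K₂ 0 (q := 5) (by norm_num) hβ0,
    eventually_term_le_div τ β (K₁ + 2 * K₃ + 2 * Real.log 16) 0 (q := 5) (by norm_num) hτβ,
    eventually_term_le_div 0 β (6 * Real.log 3) 1 (q := 5) (by norm_num) hβ0,
    eventually_term_le_div τ β (6 * K₃ + 6 * τ + 6 * Real.log 16) 1 (q := 5) (by norm_num) hτβ,
    eventually_term_le_div τ β (18 * τ) 2 (q := 5) (by norm_num) hτβ,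
    eventually_ge_atTop 1] with n e1 e2 e3 e4 e5 hn T k hT hTle hk
  have hx : (0 : ℝ) < n := by exact_mod_cast hn
  have hx1 : (1 : ℝ) ≤ n := by exact_mod_cast hn
  simp only [Real.rpow_zero, pow_zero, pow_one, mul_one] at e1 e2 e3 e4 e5
  rw [← hc, ← hX]
  obtain ⟨L, hL⟩ : ∃ L : ℝ, L = Real.log n := ⟨_, rfl⟩
  rw [← hL] at e3 e4 e5 hk
  have hL0 : 0 ≤ L := by rw [hL]; exact Real.log_nonneg hx1
  have hTr : (1 : ℝ) ≤ T := by exact_mod_cast hT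
  have hxτ : (0 : ℝ) ≤ (n : ℝ) ^ τ := Real.rpow_nonneg hx.le _
  -- `log(16 T³) ≤ log 16 + 3 τ L`
  have hlogT : Real.log (T : ℝ) ≤ τ * L := by
    rw [hL, ← Real.log_rpow hx]; exact Real.log_le_log (by linarith) hTle
  have hlog16 : Real.log (16 * (T : ℝ) ^ 3) ≤ Real.log 16 + 3 * (τ * L) := by
    rw [Real.log_mul (by norm_num) (by positivity), Real.log_pow]; push_cast; nlinarith
  have hlog160 : 0 ≤ Real.log (16 * (T : ℝ) ^ 3) := Real.log_nonneg (by nlinarith [one_le_pow₀ (n := 3) hTr])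
  -- signs
  have hl2 : 0 ≤ Real.log 2 := Real.log_nonneg (by norm_num)
  have hl2c : 0 ≤ Real.log (2 * c) := Real.log_nonneg (by linarith)
  have hl2c2 : 0 ≤ Real.log (2 * c ^ 2) := Real.log_nonneg (by nlinarith)
  have hK₁0 : 0 ≤ K₁ := by rw [hK₁]; positivity
  have hk0 : (0 : ℝ) ≤ k := Nat.cast_nonneg _
  -- bound each group
  have hA : (T + 2) * Real.log 2 + 2 * T * Real.log (2 * c) + T * Real.log (2 * c ^ 2) ≤
      K₁ * (n : ℝ) ^ τ + 2 * Real.log 2 := by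
    have h1 := mul_le_mul_of_nonneg_right hTle hl2
    have h2 := mul_le_mul_of_nonneg_right hTle hl2c
    have h3 := mul_le_mul_of_nonneg_right hTle hl2c2
    rw [hK₁]; linarith
  have hinner : Real.log 3 + T * Real.log X + T * Real.log (16 * (T : ℝ) ^ 3) ≤
      Real.log 3 + (n : ℝ) ^ τ * K₃ + (n : ℝ) ^ τ * (Real.log 16 + 3 * (τ * L)) := by
    have h1 : (T : ℝ) * K₃ ≤ (n : ℝ) ^ τ * K₃ := mul_le_mul_of_nonneg_right hTle hK₃0
    have h2 : (T : ℝ) * Real.log (16 * (T : ℝ) ^ 3) ≤ (n : ℝ) ^ τ * (Real.log 16 + 3 * (τ * L)) :=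
      mul_le_mul hTle hlog16 hlog160 hxτ
    rw [← hK₃]; linarith
  have hinner0 : 0 ≤ Real.log 3 + (n : ℝ) ^ τ * K₃ + (n : ℝ) ^ τ * (Real.log 16 + 3 * (τ * L)) := by
    positivity
  have hB : 2 * (k : ℝ) * (Real.log 3 + T * Real.log X + T * Real.log (16 * (T : ℝ) ^ 3)) ≤
      2 * (1 + 3 * L) * (Real.log 3 + (n : ℝ) ^ τ * K₃ + (n : ℝ) ^ τ * (Real.log 16 + 3 * (τ * L))) := by
    have h1 : 2 * (k : ℝ) * (Real.log 3 + T * Real.log X + T * Real.log (16 * (T : ℝ) ^ 3)) ≤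
        2 * k * (Real.log 3 + (n : ℝ) ^ τ * K₃ + (n : ℝ) ^ τ * (Real.log 16 + 3 * (τ * L))) :=
      mul_le_mul_of_nonneg_left hinner (by positivity)
    have h2 : 2 * (k : ℝ) * (Real.log 3 + (n : ℝ) ^ τ * K₃ + (n : ℝ) ^ τ * (Real.log 16 + 3 * (τ * L))) ≤
        2 * (1 + 3 * L) * (Real.log 3 + (n : ℝ) ^ τ * K₃ + (n : ℝ) ^ τ * (Real.log 16 + 3 * (τ * L))) :=
      mul_le_mul_of_nonneg_right (by linarith) hinner0
    linarith
  rw [hK₂] at e1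
  have hexp : 2 * (1 + 3 * L) * (Real.log 3 + (n : ℝ) ^ τ * K₃ + (n : ℝ) ^ τ * (Real.log 16 + 3 * (τ * L))) =
      2 * Real.log 3 + 2 * K₃ * (n : ℝ) ^ τ + 2 * Real.log 16 * (n : ℝ) ^ τ +
        6 * τ * ((n : ℝ) ^ τ * L) + 6 * Real.log 3 * L + 6 * K₃ * ((n : ℝ) ^ τ * L) +
        6 * Real.log 16 * ((n : ℝ) ^ τ * L) + 18 * τ * ((n : ℝ) ^ τ * L ^ 2) := by ring
  rw [hexp] at hB
  have e2' : (K₁ + 2 * K₃ + 2 * Real.log 16) * (n : ℝ) ^ τ ≤ (n : ℝ) ^ β / 5 := e2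
  have e4' : (6 * K₃ + 6 * τ + 6 * Real.log 16) * ((n : ℝ) ^ τ * L) ≤ (n : ℝ) ^ β / 5 := by
    rw [← mul_assoc]; exact e4
  have e5' : 18 * τ * ((n : ℝ) ^ τ * L ^ 2) ≤ (n : ℝ) ^ β / 5 := by rw [← mul_assoc]; exact e5
  rw [← hK₃] at hB ⊢
  linarith

/-- **`Γ''(T, k) ≤ n^β` for large `n`** (`1 ≤ T ≤ n^τ`, `k ≤ 1 + 3 log n`): `gamma_le` composed with
`eventually_S_le`, stated with the literal constant of `ZeroConfigK.step2_distance_sum`.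
[cite: Roy2013, §7, Step 2 ("`7T(log T)² deg Z`", absorbed for `D` large)] -/
theorem eventually_gamma_le_rpow (ξ η : ℂ) {τ β : ℝ} (hτ0 : 0 < τ) (hτβ : τ < β) :
    ∀ᶠ n : ℕ in atTop, ∀ T k : ℕ, 1 ≤ T → (T : ℝ) ≤ (n : ℝ) ^ τ → (k : ℝ) ≤ 1 + 3 * Real.log n →
    max ((max (Real.log (2 ^ T * (3 * (3 * (1 + ‖ξ‖ + ‖η‖⁻¹) * max 1 (max ‖ξ‖ ‖η‖)) ^ T *
              (16 * (T : ℝ) ^ 3) ^ T) ^ k))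
            (Real.log (2 * ((2 * roy_c2 ξ η) ^ T * (1 + roy_c2 ξ η * Real.exp (1 + roy_c2 ξ η)) *
              (3 * (3 * (1 + ‖ξ‖ + ‖η‖⁻¹) * max 1 (max ‖ξ‖ ‖η‖)) ^ T *
                (16 * (T : ℝ) ^ 3) ^ T) ^ k))) +
          |Real.log (2 * (roy_c2 ξ η * Real.exp (roy_c2 ξ η) * (2 * roy_c2 ξ η ^ 2) ^ T))|))
          (Real.log (2 ^ T * (3 * (3 * (1 + ‖ξ‖ + ‖η‖⁻¹) * max 1 (max ‖ξ‖ ‖η‖)) ^ T *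
              (16 * (T : ℝ) ^ 3) ^ T) ^ k) - T * Real.log ((2 * roy_c2 ξ η)⁻¹)) ≤ (n : ℝ) ^ β := by
  filter_upwards [eventually_S_le ξ η hτ0 hτβ] with n hn T k hT hTle hk
  exact (gamma_le ξ η hT k).trans (hn T k hT hTle hk)

end Roy2013

end Literature.NumberTheory.Transcendental
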